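import Summits.CriticalPhenomena.CardyFormulaZ2.Theorems.CardyFlipRussoQuadrupoleSelectionRuleGaussianRotation
import Summits.CriticalPhenomena.CardyFormulaZ2.Theorems.CardyFlipRussoQuadrupoleSelectionRulePartialReindex
import Literature.Probability.Percolation.TriHexagon

/-!
# The partial-rotation symmetry of the jittered triangular lattice (card A, first lemma)

Helper file for the crux `QuadrupoleSelectionRule` (stmt-CriticalPhenomena-7029, informal) of route
`CardyFlipRusso` (sub-problem `CardyFormulaZ2`), line `Sketch`: the card statement
`PartialRotationInvariance` of idea card `average-first-odd-sector-gap`, assembled from the landed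
stubs S1 (`gaussianJitter_map_rotate`: the site jitter law `N(0,1) ⊗ N(0,1)` is rotation
invariant) and S2 (`infinitePi_map_partialTransform`: an i.i.d. product measure is invariant
under "reindex by a bijection, then apply law-preserving maps coordinatewise").

The statement: the i.i.d. standard Gaussian jitter field `ξ : Site 2 → ℝ × ℝ` of the triangular
lattice (the environment randomness of the route item `JitteredTriangularLeg`) is invariant in law
under the PARTIAL ROTATION attached to a `hexRot k`-invariant set of sites `S` — the sites of `S`
receive the `60°`-rotated jitter of their `hexRot k`-preimage, the other sites keep theirs
(`TriHexagon.hexRot k` is the lattice rotation by `60°` about the site `(k, k)`).  Together with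
`triEmbed_hexRot_jitter` (stub S3: on positions this is the Euclidean rotation by `60°` about
`triEmbed (k,k)`) this is the exact symmetry "rotate the jittered lattice inside a lattice-centred
disc, freeze the outside" that card A averages over.

No new definitions: the rotation by `60°` of a jitter vector is written as the explicit map
`v ↦ (v.1 / 2 - √3/2 · v.2, √3/2 · v.1 + v.2 / 2)`.
-/

noncomputable section

open MeasureTheory ProbabilityTheory

namespace Summit.CriticalPhenomena.CardyFormulaZ2.Theorems

open Literature.Probability.LatticeModels Literature.Probability.Percolation

/-- The rotation by `60°` of a jitter vector, `v ↦ (v.1/2 - √3/2·v.2, √3/2·v.1 + v.2/2)`, is the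
rotation by the angle `π/3`. [folklore] -/
theorem rot60_eq_rotate_pi_div_three :
    (fun v : ℝ × ℝ => (v.1 / 2 - Real.sqrt 3 / 2 * v.2, Real.sqrt 3 / 2 * v.1 + v.2 / 2))
      = fun v : ℝ × ℝ => (Real.cos (Real.pi / 3) * v.1 - Real.sin (Real.pi / 3) * v.2,
          Real.sin (Real.pi / 3) * v.1 + Real.cos (Real.pi / 3) * v.2) := by
  funext v
  rw [Real.cos_pi_div_three, Real.sin_pi_div_three]
  ext <;> ring

/-- The site jitter law `N(0,1) ⊗ N(0,1)` is invariant under the rotation by `60°` (stub S1 at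
`θ = π/3`). [folklore] -/
theorem gaussianJitter_map_rot60 :
    ((gaussianReal 0 1).prod (gaussianReal 0 1)).map
        (fun v : ℝ × ℝ => (v.1 / 2 - Real.sqrt 3 / 2 * v.2, Real.sqrt 3 / 2 * v.1 + v.2 / 2))
      = (gaussianReal 0 1).prod (gaussianReal 0 1) := by
  rw [rot60_eq_rotate_pi_div_three]
  exact gaussianJitter_map_rotate _

/-- A bijection of the sites mapping `S` onto itself restricts to: `hexRot k w ∈ S ↔ w ∈ S`.
[folklore] -/
theorem hexRot_mem_iff_of_image_eq {k : ℕ} {S : Set (Site 2)} (hS : TriHexagon.hexRot k '' S = S)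
    (w : Site 2) : TriHexagon.hexRot k w ∈ S ↔ w ∈ S := by
  constructor
  · intro hw
    rw [← hS] at hw
    obtain ⟨w', hw', he⟩ := hw
    rwa [← (TriHexagon.hexRot k).injective he]
  · intro hw
    rw [← hS]
    exact ⟨w, hw, rfl⟩

/-- **Card A, first lemma (`PartialRotationInvariance`): the jitter field is invariant in law
under partial rotations.** For every `k` and every `hexRot k`-invariant set of sites `S`, the
i.i.d. standard Gaussian jitter field `Site 2 → ℝ × ℝ` of the triangular lattice is invariant in
law under the map that gives each site of `S` the `60°`-rotated jitter of its `hexRot k`-preimage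
and leaves the jitters outside `S` untouched.  Proof: the map is "reindex by the bijection
(`hexRot k` on `S`, identity off `S`), then rotate the coordinates in `S`", and both steps preserve
the product law (stubs S2 and S1). [folklore] -/
theorem jitterField_map_partialRot (k : ℕ) (S : Set (Site 2)) [DecidablePred (· ∈ S)]
    (hS : TriHexagon.hexRot k '' S = S) :
    (Measure.infinitePi (fun _ : Site 2 => (gaussianReal 0 1).prod (gaussianReal 0 1))).map
        (fun (ξ : Site 2 → ℝ × ℝ) (w : Site 2) => if w ∈ S then
          ((ξ ((TriHexagon.hexRot k).symm w)).1 / 2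
              - Real.sqrt 3 / 2 * (ξ ((TriHexagon.hexRot k).symm w)).2,
            Real.sqrt 3 / 2 * (ξ ((TriHexagon.hexRot k).symm w)).1
              + (ξ ((TriHexagon.hexRot k).symm w)).2 / 2)
          else ξ w)
      = Measure.infinitePi (fun _ : Site 2 => (gaussianReal 0 1).prod (gaussianReal 0 1)) := by
  have hmem : ∀ w, TriHexagon.hexRot k w ∈ S ↔ w ∈ S := hexRot_mem_iff_of_image_eq hS
  have hmem' : ∀ w, (TriHexagon.hexRot k).symm w ∈ S ↔ w ∈ S := fun w => by
    rw [← hmem, Equiv.apply_symm_apply]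
  -- the reindexing bijection: `hexRot k` on `S`, identity off `S`
  let e : Site 2 ≃ Site 2 :=
    { toFun := fun w => if w ∈ S then TriHexagon.hexRot k w else w
      invFun := fun w => if w ∈ S then (TriHexagon.hexRot k).symm w else w
      left_inv := fun w => by
        by_cases hw : w ∈ S
        · simp [hw, (hmem w).2 hw]
        · simp [hw]
      right_inv := fun w => by
        by_cases hw : w ∈ S
        · simp [hw, (hmem' w).2 hw]
        · simp [hw] }
  -- the coordinatewise maps: rotate by `60°` in `S`, identity off `S`
  let rot : ℝ × ℝ → ℝ × ℝ :=
    fun v => (v.1 / 2 - Real.sqrt 3 / 2 * v.2, Real.sqrt 3 / 2 * v.1 + v.2 / 2)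
  let f : Site 2 → ℝ × ℝ → ℝ × ℝ := fun w => if w ∈ S then rot else id
  have hrot : Measurable rot := by
    unfold rot
    fun_prop
  have hpr : (fun (ξ : Site 2 → ℝ × ℝ) (w : Site 2) => if w ∈ S then
          ((ξ ((TriHexagon.hexRot k).symm w)).1 / 2
              - Real.sqrt 3 / 2 * (ξ ((TriHexagon.hexRot k).symm w)).2,
            Real.sqrt 3 / 2 * (ξ ((TriHexagon.hexRot k).symm w)).1
              + (ξ ((TriHexagon.hexRot k).symm w)).2 / 2)
          else ξ w) = fun ξ i => f i (ξ (e.symm i)) := by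
    funext ξ i
    by_cases hi : i ∈ S
    · simp [f, e, rot, hi]
    · simp [f, e, hi]
  rw [hpr]
  refine infinitePi_map_partialTransform _ e f (fun i => ?_) (fun i => ?_)
  · by_cases hi : i ∈ S
    · simpa [f, hi] using hrot
    · simpa [f, hi] using measurable_id
  · by_cases hi : i ∈ S
    · simpa [f, hi] using gaussianJitter_map_rot60
    · simp [f, hi]

end Summit.CriticalPhenomena.CardyFormulaZ2.Theorems

end
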